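import Summits.AtomisticToContinuum.HydrodynamicLimit.Theses.JParityClosure
import Literature.MathematicalPhysics.KineticTheory.EvenCollisionTubeFunctional
import Literature.MathematicalPhysics.KineticTheory.HardSphereUniformGas
import Literature.MathematicalPhysics.KineticTheory.HardSphereCanonicalKSLimit
import Literature.MathematicalPhysics.KineticTheory.HardSphereCanonicalTwoClusterLimit
import Literature.MathematicalPhysics.KineticTheory.HardSphereCanonicalLabelLaw
import Summits.AtomisticToContinuum.HydrodynamicLimit.Theorems.JParityClosureEvenStressEnskogRungZeroPin
import Summits.AtomisticToContinuum.HydrodynamicLimit.Theorems.JParityClosureEvenStressEnskogPlateauWindow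
import Summits.AtomisticToContinuum.HydrodynamicLimit.Theorems.JParityClosureEvenStressEnskogRungZeroOfPlateauWindow
import Summits.AtomisticToContinuum.HydrodynamicLimit.Theorems.EvenStressEnskog.Negative.ContactValueZero
import Summits.AtomisticToContinuum.HydrodynamicLimit.Theorems.EvenStressEnskog.Negative.PairFunctionalVanishing
import Summits.AtomisticToContinuum.HydrodynamicLimit.Theorems.EvenStressEnskog.Negative.FrequencyLawReduction
import Summits.AtomisticToContinuum.HydrodynamicLimit.Theorems.EvenStressEnskog.Negative.SwappedOrderTrivial
import Summits.AtomisticToContinuum.HydrodynamicLimit.Theorems.EvenStressEnskog.Negative.EnskogSideMoments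
import Summits.AtomisticToContinuum.HydrodynamicLimit.Theorems.JParityClosureOddContactSymmetryGibbsInvariance

/-!
# Line `liouville-continuity-pins-universal-contact-value` for crux `JParityClosure.EvenStressEnskog`
# (stmt-AtomisticToContinuum-13079)

LEAD RESHAPE v1 (prover-line-stmt-AtomisticToContinuum-13079-c1-0, 2026-08-16).  The planner's three stubs (U), (R0),
(Pin) are kept with their registered texts; (R0) `stub_rungZeroEnskog` is no longer a `sorry` but is DERIVED in this
file from the landed rung-0 closure `Theorems.EvenStressEnskog.EvenStressEnskog_rung0_of_plateau_contact` (p98509), the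
DISCHARGED contact theorem `Literature.MathematicalPhysics.StatisticalMechanics.HardSphereContactTheorem_holds` (tree,
`HardSphereContactTheoremProofs.lean`) and the one remaining static input, the decorrelation plateau, which is reshaped
into four registered stubs of honest size:
* (P-a) `stub_twoClusterFactorisation` — canonical Kirkwood–Salsburg TWO-CLUSTER factorisation on `𝕋³` at contact scale
  (`v_{N+1}(Y ++ Y') ≈ v_{N+1}(Y) v_{N+1}(Y')` for clusters of microscopic diameter `≤ Lε` at mutual distance `≥ Mε`; the
  companion of the tree's `ksInv_eventually`, Ruelle §4.2 / Pulvirenti–Tsagkarogiannis 2012 in the canonical ensemble);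
* (P-b1) `stub_labelLawDensity` — the laws of two / four distinct labelled spheres under `posGibbsMeasure 1 ε (N+1)` have
  densities `vcan ε (N+1)` with respect to Haar (exchangeability + Fubini; the 2-label event form is the tree's
  `posGibbs_real_pairEvent`);
* (P-b2) `stub_plateauWindow_of_factorisation` — (P-a) ∧ (P-b1) ⇒ the WINDOWED plateau: relative decorrelation
  `|Cov| ≤ ζ vol T vol T'` of two disjoint decorated dimers whose displacement sets `T, T'` lie in the contact window
  `{d | d(d,0) ≤ C ε_N}` (near region by volume `O((M+C)³ ε³) → 0` and the a-priori bound `v ≤ 2^k`, far region by (P-a));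
* (P-c) `stub_rungZero_of_plateauWindow` — the windowed plateau suffices for the rung-0 closure: the landed variance chain
  (`abs_covariance_le_of_indicator_of_abs_le` → `variance_decoratedPairSum_le` → `variance_prod_decoratedTubeSum_le` →
  `variance_tubeStat_rung0_le` → `stub_tubeVarianceRung0_of_plateau2` → `EvenStressEnskog_rung0_of_plateau_contact`) only
  ever applies the plateau to level sets of tube marks supported in the near-contact shell
  `{ε < ‖d‖ ≤ ε(1+2Lκ)}` ⊆ window `C = 1 + 2Lκ`; re-thread it with the window hypothesis and plug in
  `HardSphereContactTheorem_holds`.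
Composition unchanged: `EvenStressEnskog_of : (U) → (R0) → (Pin) → EvenStressEnskog`, with (R0) := (P-c) ((P-b2) (P-a) (P-b1))
at `u = 0`.  Registered stubs after the reshape: `stub_universalContactLaw` (U, the bet, lead), `stub_rungZeroPin` (Pin),
`stub_twoClusterFactorisation` (P-a), `stub_labelLawDensity` (P-b1), `stub_plateauWindow_of_factorisation` (P-b2),
`stub_rungZero_of_plateauWindow` (P-c) — six `sorry`s, all but (U) static and provable now.

Skeleton (crux-plan, planner-cruxplan-stmt-AtomisticToContinuum-13079-liouville-continuity-0, 2026-08-16).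
Idea card `Cruxes/EvenStressEnskog/Ideas/liouville-continuity-pins-universal-contact-value.md` (ideator 1, round 1;
triage r1-1 pass / r1-2 pass / r1-3 fail; the panel MERGED it with `closure-invariance-principle`: same FORM/VALUE lever,
pins differing — `t = 0⁺` entropy continuity there, the equilibrium rung here; all three triagers: "pin at rung 0").
Direction: POSITIVE — `EvenStressEnskog_of` concludes the crux decl
`Summit.AtomisticToContinuum.HydrodynamicLimit.Theses.JParityClosure.EvenStressEnskog` BY NAME from three registered
stubs; `EvenStressEnskog_proof` is the crux modulo the stubs.  The stubs carry the only `sorry`s of the file.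

THE LINE (FORM/VALUE split; "identification is free, only slaving is open").  Write, for a contact LAW `F : ℝ → ℝ`,
`D_F^{kl} := K_N[χ g(σ³ρ_r) Ξ_P^{kl}] − σ³ ∫₀^τ ∫ χ g(σ³ρ_r) F(σ³ρ_r) B_r(Ξ_P^{kl}) dx ds` (tree vocabulary
`collisionSum`, `mollDensity`, `pairFunctional`, `evenMark` of `Literature/…/EvenCollisionTubeFunctional`; at the
thermodynamic contact value `F = contactValue = (3/2π)·f_ex′` this is the crux statistic `evenStat`, and
`evenStressEnskog_iff` below is the `Iff.rfl` bridge).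
(1) `stub_universalContactLaw` (U) — THE BET, value-free: the J-even collisional momentum transfer of the true flow is
    SLAVED to the local reduced density through SOME contact law `Ỹ`, continuous on the open band `(0, η₀)`, in the
    crux's own frame (all local Gibbs data, `σ < σ₀(profiles)`, all flows, `τ, χ, g`, in probability, `N → ∞` before
    `r → 0`).  Logically weaker than the crux (crux ⇒ (U) with `Ỹ := contactValue`, continuous on the band by
    `HsEosLowDensity`); fails only by MEMORY (unslaved microstructure) or by mesoscale velocity texture (Disproof §12),
    never by "wrong value".
(2) `stub_rungZeroEnskog` (R0) — the crux AT CONSTANT PROFILES `(a, 0, θ)`: under the flow-invariant canonical Gibbs law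
    (`Theorems.map_flow_localGibbsLaw_const`) the statistic `evenStat` → 0 in probability.  Statics only: exact mean by
    stationarity + the canonical contact theorem (near-contact pair law `→ Y(σ³)`), concentration by the collision tube;
    = the lead's rung-0 programme of the picked line `even-rung-mean-variance` (H4 `stub_enskogRateMeanRung0` landed,
    H5/Contact in flight) — ONE shared lemma set for the crux directory (triage r1-1/2/3).
(3) `stub_rungZeroPin` (Pin) — IDENTIFICATION LEMMA: if some `Ỹ` continuous on `(0, η_U)` satisfies (U) at the single
    constant profile `(1, 0, 1)` and (R0) holds there, then `Ỹ = contactValue` on a band `(0, η₁)`.  Proof sketch in the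
    docstring: test both at `σ³ = η*`, subtract, take the TRACE `k = l` summed (nonnegative integrand
    `(2π/3)∫∫ b_r b_r |v − v'|²`, Disproof §12 `Theta_trace_eq`), choose `g ≥ 0` concentrated at `η*`, and evaluate the
    remaining functional by the tree's canonical law of large numbers at the uniform profile (`rhoLim_uniform`,
    `tendsto_variance_uniform`, `localGibbsMeasure_rung0_eq_map`, `integral_coneKernel`) + invariance + Fubini.
(4) `evenStressEnskog_of_eqOn_band` (PROVED here; = card 1's `FirstLemmaA` / card 4's `evenStressWith_congr_pos`):
    (U) with `Ỹ` agreeing with `contactValue` on `(0, η₁)` ⇒ the crux with threshold `min η_U η₁` — a sure rewriting,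
    because the prediction integrand vanishes where `ρ_r = 0` (`B_r = 0`, the disprover's landed
    `pairFunctional_eq_zero_of_mollifiedDensity_eq_zero`) and where `σ³ρ_r ≥ min η_U η₁` (`g = 0`).
(5) `EvenStressEnskog_of : (U) → (R0) → (Pin) → EvenStressEnskog` (sorry-free): take `Ỹ, η_U` from (U); specialise (U)
    to the profile `(1, 0, 1)` and (R0) to `a = θ = 1`; (Pin) gives `η₁`; (4) concludes.

WHERE THE CARD'S LEVER WENT (triage answers).  The isothermal ENTROPY BUDGET
`H(P_t | LG₀) ≤ (N+1)·L·√(3θ)·t` (Liouville + energy conservation; re-derived by all three triagers) is CORRECT and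
provable now, but its only use in the card was the pin, and the rung-0 pin (2)+(3) reaches the same band `(0, η₁)` with
less (no inhomogeneous static LDP, no short-flight remainder under a non-stationary law, no plateau profiles): triage
r1-1 sharpen (2), r1-2 sharpen (1), r1-3 §A.  It is therefore NOT a stub of this skeleton.  Its typed statement is kept
below as a SUPPORT SIGNATURE (`IsothermalEntropyBudget`, a `def`, no `sorry`, not registered) together with the partial
result it is the tool for, `ShortTimeEnskogStress` (the crux's statistic to RELATIVE precision `η·τ` over initial
layers `τ ≤ t₀(η, δ)` for isothermal zero-drift data — the first inhomogeneous, genuinely time-evolved regime beyond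
rung 0); either may be filed `--supports stmt-AtomisticToContinuum-13079` by whoever wants a `t → 0⁺` statement.

Disproof used (`Cruxes/EvenStressEnskog/Disproof.lean`, cycles 1–2, read in full 2026-08-16T05:50Z; NO
`_false_without_<H>` theorem exists, no stub kill, `-- Targets` examine the picked line only):
§3/§5 + `Negative/ContactValueZero` — (U) asks continuity of `Ỹ` on the OPEN band `Ioo 0 η₀` only and (Pin) pins on
`Ioo 0 η₁`; nothing is evaluated or regularised at `0` (`contactValue_zero`, `not_continuousWithinAt_contactValue`
respected); §4 + `Negative/PairFunctionalVanishing` — CONSUMED by (4) (imported, not re-proved), and the load-bearing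
limit ORDER `∃ r₀ ∀ r < r₀ ∃ N₀ ∀ N ≥ N₀` is kept verbatim in all three stubs (§9 + `Negative/SwappedOrderTrivial`: the
swapped order is junk-true — no stub swaps it); §8 + `Negative/FrequencyLawReduction` and §10–§12 +
`Negative/EnskogSideMoments` — the TRACE of (U)/(R0) is the impulse-rate (collisional pressure) law, which is exactly
the functional (Pin) evaluates (`Theta_trace_eq`: `Σ_k Θ(Ξ_P^{kk})(v,w) = (2π/3)|w − v|²`, nonnegative — the sign that
makes the pin a one-line contradiction); §12 (mesoscale two-stream texture) is named in (U)'s why-might-fail: (U)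
inherits the crux's hidden "strong compactness at scale `r`" content for `τ` beyond the classical time (route-level
remark R of all triagers: restrict the crux to `τ < T` — planner's business, not this line's).  All five landed Negative
files are imported (scratch check: no stub is an instance they refute).  Negatives index (`ledger negatives
--problem AtomisticToContinuum`, 12): none is a contact-value / universality / rung-0 statement.
-/

set_option linter.dupNamespace false
set_option linter.unusedVariables false

namespace Summit.AtomisticToContinuum.HydrodynamicLimit.Cruxes.EvenStressEnskog.LiouvilleContinuityPinsUniversalContactValue

open Summit.AtomisticToContinuum.HydrodynamicLimit.Theses.JParityClosure
open scoped BigOperators Topology Classical MeasureTheory ProbabilityTheory InnerProductSpace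
open Filter Set Function MeasureTheory
open Literature.Analysis.FluidPDE Literature.MathematicalPhysics.KineticTheory

noncomputable section

/-! ## The `Iff.rfl` bridge: the crux with its prediction written over the tree vocabulary -/

/-- Definitional bridge (checked by `Iff.rfl`): `EvenStressEnskog` is the statement below with the contact LAW slot
filled by `contactValue` — the `let`-chain of the route decl is, verbatim, `collisionSum`, `mollDensity`,
`pairFunctional`, `evenMark`, `contactValue` of `EvenCollisionTubeFunctional`. [folklore] -/
theorem evenStressEnskog_iff :
    EvenStressEnskog ↔
    ∃ η₀ : ℝ, 0 < η₀ ∧ ∀ (a₀ θ₀ : T3 → ℝ) (u₀ : T3 → V3), Continuous a₀ → Continuous θ₀ → Continuous u₀ →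
      (∀ x, 0 < a₀ x) → (∀ x, 0 < θ₀ x) → ∃ σ₀ : ℝ, 0 < σ₀ ∧ ∀ σ : ℝ, 0 < σ → σ < σ₀ →
      ∀ Φ : (N : ℕ) → HardSphereFlow (Torus.geometry (Fin 3)) (hsDiameter σ N) (N + 1),
      ∀ τ : ℝ, 0 < τ → ∀ χ : ℝ × UnitAddTorus (Fin 3) → ℝ, Continuous χ → ∀ g : ℝ → ℝ, Continuous g →
      (∀ a, η₀ ≤ a → g a = 0) →
      ∀ η δ : ℝ, 0 < η → 0 < δ → ∃ r₀ : ℝ, 0 < r₀ ∧ ∀ r : ℝ, 0 < r → r < r₀ →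
      ∃ N₀ : ℕ, ∀ N : ℕ, N₀ ≤ N → ∀ k l : Fin 3,
        localGibbsLaw σ a₀ u₀ θ₀ N (Φ N)
          {z | η < |collisionSum σ N (Φ N) τ χ g (evenMark k l) r z -
                σ ^ 3 * ∫ s in Set.Icc (0 : ℝ) τ, ∫ x : UnitAddTorus (Fin 3),
                  χ (s, x) * g (σ ^ 3 * mollDensity r ((Φ N).flow s z) x) *
                    contactValue (σ ^ 3 * mollDensity r ((Φ N).flow s z) x) *
                    pairFunctional r (evenMark k l) ((Φ N).flow s z) x|}
          ≤ ENNReal.ofReal δ :=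
  Iff.rfl

/-- The same bridge through the tree's packaged statistic `evenStat` (also `Iff.rfl`). [folklore] -/
theorem evenStressEnskog_iff_evenStat :
    EvenStressEnskog ↔
    ∃ η₀ : ℝ, 0 < η₀ ∧ ∀ (a₀ θ₀ : T3 → ℝ) (u₀ : T3 → V3), Continuous a₀ → Continuous θ₀ → Continuous u₀ →
      (∀ x, 0 < a₀ x) → (∀ x, 0 < θ₀ x) → ∃ σ₀ : ℝ, 0 < σ₀ ∧ ∀ σ : ℝ, 0 < σ → σ < σ₀ →
      ∀ Φ : (N : ℕ) → HardSphereFlow (Torus.geometry (Fin 3)) (hsDiameter σ N) (N + 1),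
      ∀ τ : ℝ, 0 < τ → ∀ χ : ℝ × UnitAddTorus (Fin 3) → ℝ, Continuous χ → ∀ g : ℝ → ℝ, Continuous g →
      (∀ a, η₀ ≤ a → g a = 0) →
      ∀ η δ : ℝ, 0 < η → 0 < δ → ∃ r₀ : ℝ, 0 < r₀ ∧ ∀ r : ℝ, 0 < r → r < r₀ →
      ∃ N₀ : ℕ, ∀ N : ℕ, N₀ ≤ N → ∀ k l : Fin 3,
        localGibbsLaw σ a₀ u₀ θ₀ N (Φ N) {z | η < |evenStat σ N (Φ N) τ χ g (evenMark k l) r z|}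
          ≤ ENNReal.ofReal δ :=
  Iff.rfl

/-! ## The three registered stubs (each: the statement `Prop` `Stubs.stub_*`, then the sorried theorem `stub_*` with
the same text) -/

/-- **(U) · UNIVERSAL CONTACT LAW — the bet** (`stub_universalContactLaw`; crux-depth).  There are a contact LAW
`Ỹ : ℝ → ℝ` and a threshold `η₀ > 0`, `Ỹ` continuous on the OPEN band `(0, η₀)`, such that IN THE CRUX'S OWN FRAME
(all continuous local Gibbs profiles `(a₀, u₀, θ₀)`, `σ < σ₀(profiles)`, every family of hard-sphere flows, every
horizon `τ`, weight `χ`, density cutoff `g` vanishing on `[η₀, ∞)`, `∀ η δ ∃ r₀ ∀ r < r₀ ∃ N₀ ∀ N ≥ N₀ ∀ k l`) the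
J-even collisional momentum-transfer sum `K_N[χ g(σ³ρ_r) Ξ_P^{kl}]` is within `η` of the Enskog-FORM prediction
`σ³ ∫₀^τ∫ χ g(σ³ρ_r) Ỹ(σ³ρ_r) B_r(Ξ_P^{kl}) dx ds` with local-Gibbs probability `≥ 1 − δ`: the collisional momentum
transfer is SLAVED to the local reduced density through SOME continuous law — existence of an Euler-scale equation of
state for the contact statistics, VALUE UNKNOWN.  Why plausibly true: it is implied by the crux (`Ỹ := contactValue`,
continuous on the analyticity band of `HsEosLowDensity`) and by any loss-of-memory statement for the forward
microstructure ("two space-time points with the same local one-body state have the same contact statistics"); the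
FORM `Ỹ(σ³ρ_r)·B_r` is forced from slaving by Galilei and velocity-scaling covariance of hard spheres (no energy
scale) and by `Kn = O((N+1)^{-1/3}) → 0` (no gradient dependence at Euler order); `B_r` reads the local velocity law
only through `ρ_r, m_r` and second moments (Disproof §10–§11, `Negative/EnskogSideMoments`), so the prediction side is
h-blind.  Why it might fail / honest size: this IS propagation of local equilibrium in the two-body contact channel
with the thermodynamic constant factored out — it fails by MEMORY (hidden slow microstructure below `η₀`: pre-glassy
pockets are excluded by the cutoff `g`, but an `O(1)`-per-collision unslaved J-even contact anomaly over Euler times is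
not excluded by anything proved), and, for `τ` beyond the classical Euler time, by MESOSCALE VELOCITY TEXTURE
(Disproof §12: a two-stream texture between `λ_N` and `r` makes `B_r > 0` while `K_N = 0`, for EVERY `Ỹ ≢ 0`) — the
crux's hidden "strong compactness at scale `r`" content, inherited verbatim (route-level remark R: restrict to
`τ < T`).  Size: XL (open problem; the crux minus its constant).  NOT the crux in costume: no equation of state, no
virial theorem, no cluster expansion, nothing to all orders in `η` is asserted — the VALUE is supplied by (R0)+(Pin),
both static and provable.  Leans on (for any attack): tree `localGibbsLaw`, `HardSphereFlow`, `collisionSum`,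
`mollDensity`, `pairFunctional`, `evenMark`; route supports `CollisionTightness` (13085), `EmpiricalEnskogIdentity`
(13086, proved), `DensityCap` (13082); cards `stationary-microscale-hierarchy-entrance-law` (entrance-law route to
slaving), `rotate-fly-commutator-dlr`, `defect-hierarchy-zero-driving` (each a mechanism for the slaved FORM); the
support signature `IsothermalEntropyBudget` below (the `t = 0⁺` tool: slaving holds with `Ỹ = Y` on initial layers).
Sources: VanbeijerenErnst1973 (doi:10.1016/0031-8914(73)90372-8), Resibois1978 (doi:10.1007/bf01011771),
Lutsko1996, Lutsko2001, ErpenbeckWood1984 (doi:10.1007/bf01014387), Spohn1991 I §2.3–2.5. -/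
def Stubs.stub_universalContactLaw : Prop :=
    ∃ Yt : ℝ → ℝ, ∃ η₀ : ℝ, 0 < η₀ ∧ ContinuousOn Yt (Set.Ioo 0 η₀) ∧
      ∀ (a₀ θ₀ : T3 → ℝ) (u₀ : T3 → V3), Continuous a₀ → Continuous θ₀ → Continuous u₀ →
      (∀ x, 0 < a₀ x) → (∀ x, 0 < θ₀ x) → ∃ σ₀ : ℝ, 0 < σ₀ ∧ ∀ σ : ℝ, 0 < σ → σ < σ₀ →
      ∀ Φ : (N : ℕ) → HardSphereFlow (Torus.geometry (Fin 3)) (hsDiameter σ N) (N + 1),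
      ∀ τ : ℝ, 0 < τ → ∀ χ : ℝ × UnitAddTorus (Fin 3) → ℝ, Continuous χ → ∀ g : ℝ → ℝ, Continuous g →
      (∀ a, η₀ ≤ a → g a = 0) →
      ∀ η δ : ℝ, 0 < η → 0 < δ → ∃ r₀ : ℝ, 0 < r₀ ∧ ∀ r : ℝ, 0 < r → r < r₀ →
      ∃ N₀ : ℕ, ∀ N : ℕ, N₀ ≤ N → ∀ k l : Fin 3,
        localGibbsLaw σ a₀ u₀ θ₀ N (Φ N)
          {z | η < |collisionSum σ N (Φ N) τ χ g (evenMark k l) r z -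
                σ ^ 3 * ∫ s in Set.Icc (0 : ℝ) τ, ∫ x : UnitAddTorus (Fin 3),
                  χ (s, x) * g (σ ^ 3 * mollDensity r ((Φ N).flow s z) x) *
                    Yt (σ ^ 3 * mollDensity r ((Φ N).flow s z) x) *
                    pairFunctional r (evenMark k l) ((Φ N).flow s z) x|}
          ≤ ENNReal.ofReal δ

/-- Registered stub (U) (`Stubs.stub_universalContactLaw`, verbatim): the `sorry` to be discharged. -/
theorem stub_universalContactLaw :
    ∃ Yt : ℝ → ℝ, ∃ η₀ : ℝ, 0 < η₀ ∧ ContinuousOn Yt (Set.Ioo 0 η₀) ∧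
      ∀ (a₀ θ₀ : T3 → ℝ) (u₀ : T3 → V3), Continuous a₀ → Continuous θ₀ → Continuous u₀ →
      (∀ x, 0 < a₀ x) → (∀ x, 0 < θ₀ x) → ∃ σ₀ : ℝ, 0 < σ₀ ∧ ∀ σ : ℝ, 0 < σ → σ < σ₀ →
      ∀ Φ : (N : ℕ) → HardSphereFlow (Torus.geometry (Fin 3)) (hsDiameter σ N) (N + 1),
      ∀ τ : ℝ, 0 < τ → ∀ χ : ℝ × UnitAddTorus (Fin 3) → ℝ, Continuous χ → ∀ g : ℝ → ℝ, Continuous g →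
      (∀ a, η₀ ≤ a → g a = 0) →
      ∀ η δ : ℝ, 0 < η → 0 < δ → ∃ r₀ : ℝ, 0 < r₀ ∧ ∀ r : ℝ, 0 < r → r < r₀ →
      ∃ N₀ : ℕ, ∀ N : ℕ, N₀ ≤ N → ∀ k l : Fin 3,
        localGibbsLaw σ a₀ u₀ θ₀ N (Φ N)
          {z | η < |collisionSum σ N (Φ N) τ χ g (evenMark k l) r z -
                σ ^ 3 * ∫ s in Set.Icc (0 : ℝ) τ, ∫ x : UnitAddTorus (Fin 3),
                  χ (s, x) * g (σ ^ 3 * mollDensity r ((Φ N).flow s z) x) *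
                    Yt (σ ^ 3 * mollDensity r ((Φ N).flow s z) x) *
                    pairFunctional r (evenMark k l) ((Φ N).flow s z) x|}
          ≤ ENNReal.ofReal δ := by
  sorry

/-- **(R0) · THE CRUX AT RUNG 0** (`stub_rungZeroEnskog`; statics, L–XL).  `EvenStressEnskog` restricted to CONSTANT
profiles `a₀ ≡ a`, `u₀ ≡ 0`, `θ₀ ≡ θ` (`a, θ > 0`): there is `η₀ > 0` such that for every such profile there is `σ₀`
with, for `σ < σ₀`, every flow family, `τ, χ, g` (cutoff on `[η₀, ∞)`), `∀ η δ ∃ r₀ ∀ r < r₀ ∃ N₀ ∀ N ≥ N₀ ∀ k l`: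
`G_N(η < |evenStat …|) ≤ δ`, `G_N = localGibbsLaw σ a 0 θ N (Φ N)` the canonical hard-sphere Gibbs law × Maxwellians
(it does not depend on `a`).  Why plausibly true: `G_N` is INVARIANT under every hard-sphere flow
(`Theorems.map_flow_localGibbsLaw_const`, proved), so the law of `Φ_s z` is `G_N` at every `s` and the statement is
STATIC: (mean) by stationarity and the collision-boundary flux (Palm) identity, `E_G K_N[χ g Ξ_P^{kl}]` = `τ ×` the
flux of `G_N` through `{‖sepVec‖ = ε_N, incoming}` with mark `χ g Ξ_P^{kl}` = `σ³ τ (∫χ̄) g(σ³) Y_N(σ³) Θ̄^{kl}(θ) +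
o(1)`, `Y_N` the canonical contact value of `N + 1` spheres on `𝕋³`, and `Y_N(σ³) → contactValue σ³` on the low-density
band (CONTACT THEOREM: near-contact pair law of the canonical gas `→ (3/2π)F′(σ³)`, cluster expansion with a two-point
decoration; `HsEosLowDensity` gives `F`); the Enskog side has mean `→ σ³τ(∫χ̄) g(σ³)Y(σ³)Θ̄^{kl}` (tree
`stub_enskogRateMeanRung0`, landed); (fluctuation) both sides concentrate: the Enskog side by the canonical density LLN
at scale `r` (`tendsto_variance_uniform`), the collision side by the pre-collision tube representation + a static
U-statistic variance bound under `G_N` (diagonal `O(1/(κN))`, shared-particle terms by 3-label Ruelle bounds, disjoint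
pairs by RELATIVE decorrelation of two contact-scale pair events — the second cluster-expansion input, the XL part).
Why it might fail / honest size: no dynamical input at all (invariance is exact), so it fails only if a normalisation is
wrong (audited four times: Disproof §6.1, §7) — or never; the cost is purely static-combinatorial (L–XL).  This is the
rung-0 programme of the lead's picked line `even-rung-mean-variance` (its S1₀–S4₀, H4 landed p-ids in the crux NOTES,
H5 `stub_tubeMeanRung0OfContact` + the named fact `Contact` in flight): ONE shared lemma set — whoever closes rung 0
there closes this stub (instantiate their general-constant-profile statements; `u = 0`).  Leans on: tree
`map_flow_localGibbsLaw_const`, `localGibbsMeasure_rung0_eq_map`, `integral_localGibbsLaw_rung0`,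
`tendsto_variance_uniform`, `rhoLim_uniform`, `HardSphereCanonicalPairBound`, `HardSphereContactTheorem` (named fact
`Contact`), `Theorems.EvenStressEnskog.stub_enskogRateMeanRung0`, `evenStat_def`, `HsEosLowDensity_holds`; sources:
PulvirentiTsagkarogiannis2012 (arXiv:1105.1022, Thm 2.1), PulvirentiTsagkarogiannis2015 (doi:10.1007/s10955-015-1207-z),
HansenMcdonald2013 §2.5 (contact / virial theorem), ErpenbeckWood1984 (doi:10.1007/bf01014387: MD equation of state
from the collision rate — the statement's physics), Spohn1991 I §2.3. -/
def Stubs.stub_rungZeroEnskog : Prop :=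
    ∃ η₀ : ℝ, 0 < η₀ ∧ ∀ a θ : ℝ, 0 < a → 0 < θ → ∃ σ₀ : ℝ, 0 < σ₀ ∧ ∀ σ : ℝ, 0 < σ → σ < σ₀ →
      ∀ Φ : (N : ℕ) → HardSphereFlow (Torus.geometry (Fin 3)) (hsDiameter σ N) (N + 1),
      ∀ τ : ℝ, 0 < τ → ∀ χ : ℝ × UnitAddTorus (Fin 3) → ℝ, Continuous χ → ∀ g : ℝ → ℝ, Continuous g →
      (∀ a', η₀ ≤ a' → g a' = 0) →
      ∀ η δ : ℝ, 0 < η → 0 < δ → ∃ r₀ : ℝ, 0 < r₀ ∧ ∀ r : ℝ, 0 < r → r < r₀ →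
      ∃ N₀ : ℕ, ∀ N : ℕ, N₀ ≤ N → ∀ k l : Fin 3,
        localGibbsLaw σ (fun _ => a) (fun _ => (0 : V3)) (fun _ => θ) N (Φ N)
          {z | η < |evenStat σ N (Φ N) τ χ g (evenMark k l) r z|} ≤ ENNReal.ofReal δ

/-! ### (R0) reshaped (lead, 2026-08-16): the plateau programme

The rung-0 closure is LANDED modulo two static inputs (`EvenStressEnskog_rung0_of_plateau_contact`, p98509), and one
of them, the contact theorem, is now a tree theorem (`HardSphereContactTheorem_holds`).  The other, the decorrelation
plateau for two disjoint decorated dimers, is split below into (P-a) two-cluster factorisation of the canonical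
correlation functions at contact scale, (P-b1) the density of the labelled two- and four-point laws, (P-b2) the windowed
plateau from (P-a)+(P-b1), and (P-c) the rung-0 closure from the WINDOWED plateau (the landed chain only ever feeds
the plateau near-contact shells).  (R0) is then a theorem of this file. -/

/-- **(P-a) · CANONICAL TWO-CLUSTER FACTORISATION AT CONTACT SCALE** (`stub_twoClusterFactorisation`; statics, L–XL).
For the `N + 1`-sphere canonical gas on `𝕋³` at small reduced density (`SmallDensity uniformProfile σ`,
`ε = hsDiameter σ N`) and the normalised pinned probabilities `v_{N+1}(Y) = vcan ε (N+1) Y`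
(`HardSphereCanonicalKSLimit`; `ρ_k/(N+1)^k` up to `1 + O(k²/N)`): for every window `L` and accuracy `δ` there is a
separation `M` such that, for all large `N`, two clusters `Y` (all points within `Lε` of a centre `c`) and `Y'`
(within `Lε` of `c'`) at centre distance `≥ Mε` satisfy
`|v_{N+1}(Y ++ Y') − v_{N+1}(Y) · v_{N+1}(Y')| ≤ δ · 4^{k+k'}` (Ruelle's weighted sup-norm).  Why true / proof route:
run the tree's one-step contraction `ksInv_step` for the TWO-CLUSTER invariant
`|v_n(Y ++ Y') − g_k(lift_c Y) · g_{k'}(lift_{c'} Y')| ≤ b 4^{k+k'}` (peel the first point of `Y` by the canonical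
Kirkwood–Salsburg identity `vcan_cons` / `pinnedXi_cons_eq_sum`, the second cluster riding along: the new pinned points
lie in `B(y₁, ε)`, so the window doubles per step exactly as in `ksInv_iterate`, and the wall factor against `Y'` is `1`
because `d(c, c') ≥ Mε > (2^s L + 2^s L + 1)ε`; base `k = 0` is the one-cluster invariant `KSInv` at the same level,
supplied by `ksInv_iterate`), `s` steps from the trivial bound `2 · 4^{k+k'}`, coefficient errors `etaErr → 0`
(`tendsto_etaErr`); finally `|g g' − v v'| ≤ 2δ 4^{k+k'}` by `ksInv_eventually` twice.  No cluster property of the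
infinite-volume state is needed (the comparison is with the PRODUCT `g_k g_{k'}`, which is what the peeling reproduces).
Why it might fail: only by bookkeeping (`Fin.append`/`Fin.cons` reshuffles via `pinnedXi_comp_equiv`; levels `n − k`
with `ℕ`-subtraction are guarded as in `vcan_le_two_pow'`).  Size L–XL (≈ the size of `HardSphereCanonicalKSLimit`'s
§§ "one-step estimate"–"iterating").  Leans on: `vcan_cons`, `pinnedXi_cons_eq_sum`, `pinnedXi_comp_equiv`,
`pinnedXi_const_add`, `ksInv_step` (pattern), `ksInv_iterate`, `ksInv_eventually`, `tendsto_etaErr`, `gLim_succ`,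
`abs_gLim_le`, `vcan_le_two_pow'`, `integral_ballInd_mul_eq_pow_mul`, `liftAt_*`; sources Ruelle1969 §4.2.2–4.2.3,
PulvirentiTsagkarogiannis2012 Thm 2.1 / §5, PulvirentiTsagkarogiannis2015 (decay of correlations, canonical ensemble).
[cite: Ruelle1969, §4.2.3] -/
def Stubs.stub_twoClusterFactorisation : Prop :=
    ∀ σ : ℝ, SmallDensity uniformProfile σ → ∀ L : ℝ, 0 < L → ∀ δ : ℝ, 0 < δ →
      ∃ M : ℝ, 0 < M ∧ ∃ N₀ : ℕ, ∀ N : ℕ, N₀ ≤ N →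
      ∀ (k k' : ℕ) (Y : Fin k → T3) (Y' : Fin k' → T3) (c c' : T3),
        (∀ a, Torus.euclidDist (Y a) c < L * hsDiameter σ N) →
        (∀ a, Torus.euclidDist (Y' a) c' < L * hsDiameter σ N) →
        M * hsDiameter σ N ≤ Torus.euclidDist c c' →
        |vcan (hsDiameter σ N) (N + 1) (Fin.append Y Y') -
            vcan (hsDiameter σ N) (N + 1) Y * vcan (hsDiameter σ N) (N + 1) Y'| ≤ δ * 4 ^ (k + k')

/-- Registered stub (P-a) (`Stubs.stub_twoClusterFactorisation`, verbatim): LANDED — `Literature.MathematicalPhysics.KineticTheory.vcan_append_sub_mul_le`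
(Literature/…/HardSphereCanonicalTwoCluster.lean p112368 + …TwoClusterLimit.lean p115782, wave 1). [cite: Ruelle1969, §4.2.3] -/
theorem stub_twoClusterFactorisation :
    ∀ σ : ℝ, SmallDensity uniformProfile σ → ∀ L : ℝ, 0 < L → ∀ δ : ℝ, 0 < δ →
      ∃ M : ℝ, 0 < M ∧ ∃ N₀ : ℕ, ∀ N : ℕ, N₀ ≤ N →
      ∀ (k k' : ℕ) (Y : Fin k → T3) (Y' : Fin k' → T3) (c c' : T3),
        (∀ a, Torus.euclidDist (Y a) c < L * hsDiameter σ N) →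
        (∀ a, Torus.euclidDist (Y' a) c' < L * hsDiameter σ N) →
        M * hsDiameter σ N ≤ Torus.euclidDist c c' →
        |vcan (hsDiameter σ N) (N + 1) (Fin.append Y Y') -
            vcan (hsDiameter σ N) (N + 1) Y * vcan (hsDiameter σ N) (N + 1) Y'| ≤ δ * 4 ^ (k + k') :=
  Literature.MathematicalPhysics.KineticTheory.vcan_append_sub_mul_le

/-- **(P-b1) · DENSITY OF THE LABELLED TWO- AND FOUR-POINT LAWS** (`stub_labelLawDensity`; statics, M).  Under the
activity-`1` canonical configurational measure `P_N = posGibbsMeasure 1 ε_N (N+1)` at small reduced density, for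
distinct labels the law of `(x_i, x_j)` has density `vcan ε_N (N+1)` on `(𝕋³)²` and the law of `(x_i, x_j, x_k, x_l)`
has density `vcan ε_N (N+1)` on `(𝕋³)⁴`, both with respect to Haar measure:
`E_{P_N} F(x_i, x_j) = ∫ F(y) v_{N+1}(y) dy` and `E_{P_N} F(x_i, x_j, x_k, x_l) = ∫ F(y) v_{N+1}(y) dy` for bounded
measurable `F`.  Why true: `P_N` is the normalised restriction of Haar^{⊗(N+1)} to the hard-core set
(`posGibbsMeasure_eq`, `XiT_eq_hcProb`); relabel by a permutation taking `(i, j, k, l)` to `(0, 1, 2, 3)`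
(`measurePreserving_comp_perm`, `comp_perm_mem_hcSet_iff`, pattern `measureReal_hcSet_inter_pairEvent_ij` /
`posGibbs_real_pairEvent` of `HardSphereContactTheoremProofs`), and integrate out the `N + 1 − 4` free labels
(Fubini: the inner Haar integral of the hard-core indicator is `pinnedXi ε y (N+1−4)` by definition, cf.
`hcProb_firstLabels_eq_pinnedXi`).  Why it might fail: it cannot (exact identity); `N ≥ 3` is forced by the four
distinct labels, and `Ξ_ε(N+1) > 0` by `XiT_pos`.  Size M.  Leans on: `posGibbsMeasure_eq`, `XiT_eq_hcProb`,
`hardCoreSet_univ_eq_hcSet`, `hcProb_firstLabels_eq_pinnedXi`, `measurePreserving_comp_perm`, `pinnedXi`, `vcan`,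
`XiT_pos`, Mathlib `MeasureTheory.integral_prod` / `Measure.pi` Fubini (`MeasureTheory.integral_fin_nat_prod_eq_prod`-type
splittings via `MeasurableEquiv.piFinSumEquiv` / `Fin.appendEquiv`). [folklore] -/
def Stubs.stub_labelLawDensity : Prop :=
    ∀ σ : ℝ, SmallDensity uniformProfile σ → ∀ (N : ℕ),
      (∀ (i j : Fin (N + 1)), i ≠ j → ∀ F : (Fin 2 → T3) → ℝ, Measurable F → (∃ C : ℝ, ∀ y, |F y| ≤ C) →
        ∫ x, F ![x i, x j] ∂posGibbsMeasure (fun _ : T3 => (1 : ℝ)) (hsDiameter σ N) (N + 1) =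
          ∫ y : Fin 2 → T3, F y * vcan (hsDiameter σ N) (N + 1) y) ∧
      (∀ (i j k l : Fin (N + 1)), i ≠ j → i ≠ k → i ≠ l → j ≠ k → j ≠ l → k ≠ l →
        ∀ F : (Fin 4 → T3) → ℝ, Measurable F → (∃ C : ℝ, ∀ y, |F y| ≤ C) →
        ∫ x, F ![x i, x j, x k, x l] ∂posGibbsMeasure (fun _ : T3 => (1 : ℝ)) (hsDiameter σ N) (N + 1) =
          ∫ y : Fin 4 → T3, F y * vcan (hsDiameter σ N) (N + 1) y)

/-- Registered stub (P-b1) (`Stubs.stub_labelLawDensity`, verbatim): LANDED — `Literature.MathematicalPhysics.KineticTheory.integral_labelLaw_eq_integral_mul_vcan`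
(Literature/…/HardSphereCanonicalLabelLaw.lean p119561, wave 1). [folklore] -/
theorem stub_labelLawDensity :
    ∀ σ : ℝ, SmallDensity uniformProfile σ → ∀ (N : ℕ),
      (∀ (i j : Fin (N + 1)), i ≠ j → ∀ F : (Fin 2 → T3) → ℝ, Measurable F → (∃ C : ℝ, ∀ y, |F y| ≤ C) →
        ∫ x, F ![x i, x j] ∂posGibbsMeasure (fun _ : T3 => (1 : ℝ)) (hsDiameter σ N) (N + 1) =
          ∫ y : Fin 2 → T3, F y * vcan (hsDiameter σ N) (N + 1) y) ∧
      (∀ (i j k l : Fin (N + 1)), i ≠ j → i ≠ k → i ≠ l → j ≠ k → j ≠ l → k ≠ l →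
        ∀ F : (Fin 4 → T3) → ℝ, Measurable F → (∃ C : ℝ, ∀ y, |F y| ≤ C) →
        ∫ x, F ![x i, x j, x k, x l] ∂posGibbsMeasure (fun _ : T3 => (1 : ℝ)) (hsDiameter σ N) (N + 1) =
          ∫ y : Fin 4 → T3, F y * vcan (hsDiameter σ N) (N + 1) y) :=
  Literature.MathematicalPhysics.KineticTheory.integral_labelLaw_eq_integral_mul_vcan

/-- **The WINDOWED PLATEAU** (statement shared by (P-b2) and (P-c); NOT a stub by itself): relative asymptotic
independence of two disjoint decorated dimers `h(x_i)𝟙_T(x_j − x_i)`, `h'(x_k)𝟙_{T'}(x_l − x_k)` under the activity-`1`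
canonical configurational measure, `|Cov| ≤ ζ vol(T) vol(T')` for `N ≥ N₀(σ, C, ζ)`, for displacement sets `T, T'`
inside the contact WINDOW `{d | d(d, 0) ≤ C ε_N}` — verbatim the plateau hypothesis of the landed
`EvenStressEnskog_rung0_of_plateau_contact` plus the window `C` and the two inclusion hypotheses. [folklore] -/
def PlateauWindow : Prop :=
    ∃ σ₁ : ℝ, 0 < σ₁ ∧ ∀ σ : ℝ, 0 < σ → σ < σ₁ → ∀ C : ℝ, 1 ≤ C → ∀ ζ : ℝ, 0 < ζ → ∃ N₀ : ℕ, ∀ N : ℕ, N₀ ≤ N →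
      ∀ i j k l : Fin (N + 1), i ≠ j → i ≠ k → i ≠ l → j ≠ k → j ≠ l → k ≠ l →
      ∀ (h h' : T3 → ℝ), Measurable h → Measurable h' → (∀ y, |h y| ≤ 1) → (∀ y, |h' y| ≤ 1) →
      ∀ T T' : Set T3, MeasurableSet T → MeasurableSet T' →
      T ⊆ {d | Torus.euclidDist d 0 ≤ C * hsDiameter σ N} → T' ⊆ {d | Torus.euclidDist d 0 ≤ C * hsDiameter σ N} →
      |(∫ x, h (x i) * T.indicator (fun _ => (1 : ℝ)) (x j - x i) * (h' (x k) * T'.indicator (fun _ => (1 : ℝ)) (x l - x k))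
          ∂posGibbsMeasure (fun _ : T3 => (1 : ℝ)) (hsDiameter σ N) (N + 1)) -
        (∫ x, h (x i) * T.indicator (fun _ => (1 : ℝ)) (x j - x i)
          ∂posGibbsMeasure (fun _ : T3 => (1 : ℝ)) (hsDiameter σ N) (N + 1)) *
        (∫ x, h' (x k) * T'.indicator (fun _ => (1 : ℝ)) (x l - x k)
          ∂posGibbsMeasure (fun _ : T3 => (1 : ℝ)) (hsDiameter σ N) (N + 1))|
        ≤ ζ * (volume T).toReal * (volume T').toReal

/-- **(P-b2) · THE WINDOWED PLATEAU FROM TWO-CLUSTER FACTORISATION** (`stub_plateauWindow_of_factorisation`; statics,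
M–L).  (P-a) ∧ (P-b1) ⇒ `PlateauWindow`.  Proof sketch: by (P-b1) the covariance is
`∫_{(𝕋³)⁴} h(y₀)𝟙_T(y₁ − y₀) h'(y₂)𝟙_{T'}(y₃ − y₂) [v(y) − v(y₀,y₁) v(y₂,y₃)] dy` (`Fin.append ![y₀,y₁] ![y₂,y₃] = ![y₀,y₁,y₂,y₃]`);
bound `|h|, |h'| ≤ 1`, substitute `q = y₁ − y₀ ∈ T`, `q' = y₃ − y₂ ∈ T'` (Haar translation invariance on each factor) to get
`≤ vol T · vol T' · sup_{q ∈ T, q' ∈ T'} ∫∫ |v(y₀, y₀+q, y₂, y₂+q') − v(y₀,y₀+q) v(y₂,y₂+q')| dy₀ dy₂`; split the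
`y₂`-integral at `d(y₀, y₂) = (M + 1)ε` with `M` from (P-a) run at window `L := C + 1` and accuracy `δ := ζ/(3 · 4⁴)`:
NEAR part `≤ (2⁴ + 2²·2²) · vol{d(·, y₀) < (M+1)ε} ≤ 32 (4π/3)((M+1)ε_N)³ → 0` (`vcan_le_two_pow'`,
`Torus.volume_ball_le`-type bound), FAR part `≤ δ 4⁴` by (P-a) with centres `c = y₀`, `c' = y₂` (the dimer `![y₀, y₀+q]`
lies within `(C+1)ε > Cε ≥ d(q,0)` of `y₀`); choose `N₀` with the near part `≤ ζ/3`.  Why it might fail: it cannot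
(measure-theoretic plumbing: Fubini on `(𝕋³)⁴`, `Measure.pi` translation invariance `volume_preimage_add`/`map_add_right`,
measurability of `vcan ∘ _` by `measurable_vcan_comp`).  Size M–L.  Leans on: (P-a), (P-b1), `vcan_le_two_pow'`,
`vcan_nonneg`, `measurable_vcan_comp`, `Torus.euclidDist_*` (triangle, `comm`, `self`), Haar volume of small balls on `T3`
(`Torus.volume_closedBall_le` / `volume_real_torusShell_le` pattern), `exists_smallDensity`. [folklore] -/
def Stubs.stub_plateauWindow_of_factorisation : Prop :=
    Stubs.stub_twoClusterFactorisation → Stubs.stub_labelLawDensity → PlateauWindow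

/-- Registered stub (P-b2) (`Stubs.stub_plateauWindow_of_factorisation`, verbatim): LANDED — `Theorems.EvenStressEnskog.plateauWindow_of_twoCluster_labelLaw`
(Theorems/JParityClosureEvenStressEnskogPlateauWindow.lean p120767, wave 1; registered under that name with the unfolded text). [folklore] -/
theorem stub_plateauWindow_of_factorisation :
    Stubs.stub_twoClusterFactorisation → Stubs.stub_labelLawDensity → PlateauWindow :=
  _root_.Summit.AtomisticToContinuum.HydrodynamicLimit.Theorems.EvenStressEnskog.plateauWindow_of_twoCluster_labelLaw

/-- **(P-c) · RUNG 0 FROM THE WINDOWED PLATEAU** (`stub_rungZero_of_plateauWindow`; statics + bookkeeping, L).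
`PlateauWindow` ⇒ the conclusion of the landed `EvenStressEnskog_rung0_of_plateau_contact` (the crux at constant profiles
`(a, u, θ)`), unconditionally: the contact theorem is `HardSphereContactTheorem_holds`, and the plateau is only ever
applied, inside the landed chain `Literature.Probability.Moments.abs_covariance_le_of_indicator_of_abs_le` (layer cake:
level sets `{f > t} ⊆ D` of a tube mark `f ≥ 0` supported in the shell `D`) → `abs_covariance_decorated_le_of_dec` →
`abs_covariance_decorated_le` → `variance_decoratedPairSum_le` (`HardSphereDecoratedPairSumVariance`) →
`variance_prod_decoratedTubeSum_le` (`CollisionTubeDecoratedSumVariance`: `D = {ε < ‖reprSym d‖ ≤ ε(1+2Lκ)}`) →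
`variance_tubeStat_rung0_le` (`CollisionTubeVarianceRung0`) → `stub_tubeVarianceRung0_of_plateau2` (Theorems
`…TubeVarianceRung0`) → `EvenStressEnskog_rung0_of_plateau_contact` (Theorems `…Rung0Closure`), to subsets of the
near-contact shell, which lies in the window `C = 1 + 2Lκ ≤ 1 + 2L` (`Torus.euclidDist d 0 = ‖reprSym d‖`); re-thread
each link with the two inclusion hypotheses (append-only primed variants, proofs otherwise verbatim).  Why it might fail:
it cannot (the chain's quantifier order fixes `L, κ` before `N₀`).  Size L (mechanical).  Leans on: the eight theorems
named, `HardSphereContactTheorem_holds`. [folklore] -/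
def Stubs.stub_rungZero_of_plateauWindow : Prop :=
    PlateauWindow →
    ∃ η₀ : ℝ, 0 < η₀ ∧ ∀ (a θ : ℝ) (u : V3), 0 < a → 0 < θ → ∃ σ₀ : ℝ, 0 < σ₀ ∧ ∀ σ : ℝ, 0 < σ → σ < σ₀ →
      ∀ Φ : (N : ℕ) → HardSphereFlow (Torus.geometry (Fin 3)) (hsDiameter σ N) (N + 1),
      ∀ τ : ℝ, 0 < τ → ∀ χ : ℝ × UnitAddTorus (Fin 3) → ℝ, Continuous χ → ∀ g : ℝ → ℝ, Continuous g →
      (∀ a, η₀ ≤ a → g a = 0) →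
      ∀ η δ : ℝ, 0 < η → 0 < δ → ∃ r₀ : ℝ, 0 < r₀ ∧ ∀ r : ℝ, 0 < r → r < r₀ →
      ∃ N₀ : ℕ, ∀ N : ℕ, N₀ ≤ N → ∀ k l : Fin 3,
        localGibbsLaw σ (fun _ => a) (fun _ => u) (fun _ => θ) N (Φ N)
          {z | η < |evenStat σ N (Φ N) τ χ g (evenMark k l) r z|} ≤ ENNReal.ofReal δ

/-- Registered stub (P-c) (`Stubs.stub_rungZero_of_plateauWindow`, verbatim): LANDED — `Theorems.EvenStressEnskog.rungZero_of_plateauWindow`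
(Theorems/JParityClosureEvenStressEnskogRungZeroOfPlateauWindow.lean p121189 over Literature/…/CollisionTubeVarianceRung0Window.lean p121113 and
…/HardSphereDecoratedPairSumVarianceWindow.lean, wave 1; registered under that name with the unfolded text). [folklore] -/
theorem stub_rungZero_of_plateauWindow :
    PlateauWindow →
    ∃ η₀ : ℝ, 0 < η₀ ∧ ∀ (a θ : ℝ) (u : V3), 0 < a → 0 < θ → ∃ σ₀ : ℝ, 0 < σ₀ ∧ ∀ σ : ℝ, 0 < σ → σ < σ₀ →
      ∀ Φ : (N : ℕ) → HardSphereFlow (Torus.geometry (Fin 3)) (hsDiameter σ N) (N + 1),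
      ∀ τ : ℝ, 0 < τ → ∀ χ : ℝ × UnitAddTorus (Fin 3) → ℝ, Continuous χ → ∀ g : ℝ → ℝ, Continuous g →
      (∀ a, η₀ ≤ a → g a = 0) →
      ∀ η δ : ℝ, 0 < η → 0 < δ → ∃ r₀ : ℝ, 0 < r₀ ∧ ∀ r : ℝ, 0 < r → r < r₀ →
      ∃ N₀ : ℕ, ∀ N : ℕ, N₀ ≤ N → ∀ k l : Fin 3,
        localGibbsLaw σ (fun _ => a) (fun _ => u) (fun _ => θ) N (Φ N)
          {z | η < |evenStat σ N (Φ N) τ χ g (evenMark k l) r z|} ≤ ENNReal.ofReal δ :=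
  _root_.Summit.AtomisticToContinuum.HydrodynamicLimit.Theorems.EvenStressEnskog.rungZero_of_plateauWindow

/-- **(R0) DERIVED** (`stub_rungZeroEnskog`, the planner's registered text, now a theorem of the skeleton): the crux at
constant profiles `(a, 0, θ)` from (P-a), (P-b1), (P-b2), (P-c) — specialise the general-drift rung-0 closure to `u = 0`.
[folklore] -/
theorem stub_rungZeroEnskog :
    ∃ η₀ : ℝ, 0 < η₀ ∧ ∀ a θ : ℝ, 0 < a → 0 < θ → ∃ σ₀ : ℝ, 0 < σ₀ ∧ ∀ σ : ℝ, 0 < σ → σ < σ₀ →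
      ∀ Φ : (N : ℕ) → HardSphereFlow (Torus.geometry (Fin 3)) (hsDiameter σ N) (N + 1),
      ∀ τ : ℝ, 0 < τ → ∀ χ : ℝ × UnitAddTorus (Fin 3) → ℝ, Continuous χ → ∀ g : ℝ → ℝ, Continuous g →
      (∀ a', η₀ ≤ a' → g a' = 0) →
      ∀ η δ : ℝ, 0 < η → 0 < δ → ∃ r₀ : ℝ, 0 < r₀ ∧ ∀ r : ℝ, 0 < r → r < r₀ →
      ∃ N₀ : ℕ, ∀ N : ℕ, N₀ ≤ N → ∀ k l : Fin 3,
        localGibbsLaw σ (fun _ => a) (fun _ => (0 : V3)) (fun _ => θ) N (Φ N)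
          {z | η < |evenStat σ N (Φ N) τ χ g (evenMark k l) r z|} ≤ ENNReal.ofReal δ := by
  obtain ⟨η₀, hη₀, H⟩ := stub_rungZero_of_plateauWindow
    (stub_plateauWindow_of_factorisation stub_twoClusterFactorisation stub_labelLawDensity)
  exact ⟨η₀, hη₀, fun a θ ha hθ => H a θ 0 ha hθ⟩

/-- **(Pin) · RUNG 0 IDENTIFIES EVERY CONTINUOUS SLAVED LAW** (`stub_rungZeroPin`; M–L, statics + bookkeeping).  If
`Ỹ` is continuous on `(0, η_U)` and the universal statement (U) holds for `Ỹ` at the ONE constant profile `(1, 0, 1)`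
(cutoff threshold `η_U`), and the rung-0 statement (R0) holds at the same profile (threshold `η_R`), then
`Ỹ = contactValue` on some band `(0, η₁)`.  Proof sketch (all inputs in the tree).  Let `η_an` be the analyticity
threshold of `HsEosLowDensity` (`HsEosLowDensity_holds`; `contactValue = (3/2π)F′` is continuous on `(0, η_an)`),
`σ_U, σ_R` the two `σ₀`'s, `σ_p ≤ 1/2` with `G_N^σ := localGibbsLaw σ 1 0 1 N (Φ N)` a probability measure and the
uniform canonical LLN in force for `σ < σ_p` (`isProbabilityMeasure_localGibbsLaw`, `localGibbs_lln_holds` /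
`HardSphereUniformGas`); put `η₁ := min (η_U, η_R, η_an, σ_U³, σ_R³, σ_p³)`.  Fix `η* ∈ (0, η₁)` and suppose
`d := Ỹ(η*) − Y(η*) ≠ 0`, say `d > 0` (the other sign is symmetric).  By continuity pick `ι ∈ (0, η*/2)` with
`Ỹ − Y ≥ d/2` on `[η* − 2ι, η* + 2ι] ⊂ (0, min(η_U, η_R, η_an))`; set `σ := (η*)^{1/3}`, `τ := 1`, `χ ≡ 1`, pick flows
`Φ` (`HardSphereFlow.nonempty_torus_holds`), and a continuous `0 ≤ g ≤ 1`, `g = 1` on `[η* − ι, η* + ι]`, supported in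
`[η* − 2ι, η* + 2ι]` (so `g = 0` on `[η_U, ∞)` and on `[η_R, ∞)`).  For `η, δ > 0`, `r < min(r₀^U, r₀^R)(η, δ)`,
`N ≥ max N₀`, summing the three diagonal instances `k = l` of each hypothesis and subtracting (`collisionSum` cancels):
`G(6η < X) ≤ 6δ` with `X(z) := σ³ ∫₀¹ ∫ₓ g(σ³ρ_r)(Ỹ − Y)(σ³ρ_r) T_r (Φ_s z, x) dx ds`, `T_r := Σ_k B_r(Ξ_P^{kk}) =
(2π/3) ∫∫ b_r b_r |v − v'|² dμ_z dμ_z ≥ 0` (`Theta_trace_eq` / `pairFunctionalP_eq_moment`; finite sums, so linearity is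
elementary; the value: `Σ_k Θ(Ξ_P^{kk})(v,w) = ∫((w−v)·ω)₊² dω = ½∫((w−v)·ω)² dω = (2π/3)|w−v|²`, `|S²| = 4π`,
`sphereMarkP_eq_half`).  Pointwise `g(Ỹ − Y)T_r ≥ (d/2)·1{|σ³ρ_r − η*| ≤ ι}·T_r ≥ 0`, hence `X ≥ σ³(d/2)·W`,
`W(z) := ∫₀¹∫ₓ 1{|ρ_r − 1| ≤ ι/η*} T_r (Φ_s z, x)`.  STATIC EVALUATION of `W`: by invariance
(`map_flow_localGibbsLaw_const`) and Fubini, `E_G |W − 4π| ≤ E_G ∫ₓ |1{|ρ_r(z,x) − 1| ≤ ι/η*} T_r(z,x) − 4π| dx`, and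
for each `x` (fixed test function `b_r(·, x)`, mass `1` by `integral_coneKernel`, `r < 1/2`): `ρ_r(z, x) → 1`
(`rhoLim_uniform`, `tendsto_variance_uniform`), `T_r(z,x) = (4π/3)(ρ_r e_r − |j_r|²) → (4π/3)(1·3 − 0) = 4π` in
`G`-probability (velocities i.i.d. `N(0, 𝟙)` given positions, `localGibbsMeasure_rung0_eq_map`; Chebyshev), with
`T_r ≤ (8π/3)‖b_r‖_∞² (N+1)⁻¹Σ|v_i|²` uniformly integrable; Vitali + dominated convergence over `𝕋³` give
`E_G|W − 4π| → 0`, so `G(W ≤ 2π) → 0`.  Choose `η := π d σ³/6`, `δ := 1/24`: `G(W > 2π) ≤ G(X > 6η) ≤ 1/4` for all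
large `N`, contradicting `G(W > 2π) → 1`.  Hence `Ỹ = Y` on `(0, η₁)`.  Why it might fail: it cannot once (U)|₍₁,₀,₁₎
and (R0) are granted — every limit is a tree theorem; the only traps are junk conventions (`G` a probability measure
needs `σ ≤ 1/2`; `r < 1/2` for `∫ b_r = 1`; the subtraction `P_Ỹ − P_Y = X` needs both Bochner integrals non-junk, i.e.
integrability of the Enskog-type rate along `G`-a.e. orbit — exactly the regularity landed for the lead's S6,
`Theorems.EvenStressEnskog.measurable_enskogRate_uncurry` / `exists_bound_enskogRate` / `stub_evenTubeStatRegular`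
(p77220), run once with `contactValue` and once with `g·Ỹ`, which is bounded continuous since `supp g ⊂ (0, η_U)`;
handle `T_r` through its finite-sum form `pairFunctional_eq_sum`).  Size M–L (measure-theoretic plumbing; no new
mathematics).  Leans on: tree `HsEosLowDensity_holds`, `isProbabilityMeasure_localGibbsLaw`,
`HardSphereFlow.nonempty_torus_holds`, `map_flow_localGibbsLaw_const`, `localGibbsMeasure_rung0_eq_map`,
`integral_localGibbsLaw_rung0`, `rhoLim_uniform`, `tendsto_variance_uniform`, `integral_coneKernel`,
`Theorems.EvenStressEnskog.{pairFunctional_eq_sum, mollDensity_eq_sum, continuous_mollDensity_comp,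
continuous_pairFunctional_comp, measurable_enskogRate_uncurry, exists_bound_mul_contactValue, exists_bound_enskogRate}`
(TubeStatRegular file), `Negative/EnskogSideMoments` (`sphereMarkP_eq_half`, `pairFunctionalP_eq_moment`,
`integral_prod_empiricalMeasure`), `Theta_trace_eq` (Disproof §12; re-prove as a one-liner), Mathlib
`MeasureTheory.tendstoInMeasure_of_tendsto_eLpNorm`, Vitali convergence; sources: Spohn1991 I §2.3,
PulvirentiTsagkarogiannis2012 (arXiv:1105.1022). -/
def Stubs.stub_rungZeroPin : Prop :=
    ∀ (Yt : ℝ → ℝ) (ηU ηR : ℝ), 0 < ηU → 0 < ηR → ContinuousOn Yt (Set.Ioo 0 ηU) →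
      (∃ σ₀ : ℝ, 0 < σ₀ ∧ ∀ σ : ℝ, 0 < σ → σ < σ₀ →
        ∀ Φ : (N : ℕ) → HardSphereFlow (Torus.geometry (Fin 3)) (hsDiameter σ N) (N + 1),
        ∀ τ : ℝ, 0 < τ → ∀ χ : ℝ × UnitAddTorus (Fin 3) → ℝ, Continuous χ → ∀ g : ℝ → ℝ, Continuous g →
        (∀ a, ηU ≤ a → g a = 0) →
        ∀ η δ : ℝ, 0 < η → 0 < δ → ∃ r₀ : ℝ, 0 < r₀ ∧ ∀ r : ℝ, 0 < r → r < r₀ →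
        ∃ N₀ : ℕ, ∀ N : ℕ, N₀ ≤ N → ∀ k l : Fin 3,
          localGibbsLaw σ (fun _ => (1 : ℝ)) (fun _ => (0 : V3)) (fun _ => (1 : ℝ)) N (Φ N)
            {z | η < |collisionSum σ N (Φ N) τ χ g (evenMark k l) r z -
                  σ ^ 3 * ∫ s in Set.Icc (0 : ℝ) τ, ∫ x : UnitAddTorus (Fin 3),
                    χ (s, x) * g (σ ^ 3 * mollDensity r ((Φ N).flow s z) x) *
                      Yt (σ ^ 3 * mollDensity r ((Φ N).flow s z) x) *
                      pairFunctional r (evenMark k l) ((Φ N).flow s z) x|}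
            ≤ ENNReal.ofReal δ) →
      (∃ σ₀ : ℝ, 0 < σ₀ ∧ ∀ σ : ℝ, 0 < σ → σ < σ₀ →
        ∀ Φ : (N : ℕ) → HardSphereFlow (Torus.geometry (Fin 3)) (hsDiameter σ N) (N + 1),
        ∀ τ : ℝ, 0 < τ → ∀ χ : ℝ × UnitAddTorus (Fin 3) → ℝ, Continuous χ → ∀ g : ℝ → ℝ, Continuous g →
        (∀ a, ηR ≤ a → g a = 0) →
        ∀ η δ : ℝ, 0 < η → 0 < δ → ∃ r₀ : ℝ, 0 < r₀ ∧ ∀ r : ℝ, 0 < r → r < r₀ →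
        ∃ N₀ : ℕ, ∀ N : ℕ, N₀ ≤ N → ∀ k l : Fin 3,
          localGibbsLaw σ (fun _ => (1 : ℝ)) (fun _ => (0 : V3)) (fun _ => (1 : ℝ)) N (Φ N)
            {z | η < |evenStat σ N (Φ N) τ χ g (evenMark k l) r z|} ≤ ENNReal.ofReal δ) →
      ∃ η₁ : ℝ, 0 < η₁ ∧ Set.EqOn Yt contactValue (Set.Ioo 0 η₁)

/-- Registered stub (Pin) (`Stubs.stub_rungZeroPin`, verbatim): LANDED — `Theorems.EvenStressEnskog.stub_rungZeroPin` (Theorems/…RungZeroPin.lean p111010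
over …RungZeroPinHelpers.lean p103732 and …RungZeroPinLLN.lean p105535, wave 1). [folklore] -/
theorem stub_rungZeroPin :
    ∀ (Yt : ℝ → ℝ) (ηU ηR : ℝ), 0 < ηU → 0 < ηR → ContinuousOn Yt (Set.Ioo 0 ηU) →
      (∃ σ₀ : ℝ, 0 < σ₀ ∧ ∀ σ : ℝ, 0 < σ → σ < σ₀ →
        ∀ Φ : (N : ℕ) → HardSphereFlow (Torus.geometry (Fin 3)) (hsDiameter σ N) (N + 1),
        ∀ τ : ℝ, 0 < τ → ∀ χ : ℝ × UnitAddTorus (Fin 3) → ℝ, Continuous χ → ∀ g : ℝ → ℝ, Continuous g →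
        (∀ a, ηU ≤ a → g a = 0) →
        ∀ η δ : ℝ, 0 < η → 0 < δ → ∃ r₀ : ℝ, 0 < r₀ ∧ ∀ r : ℝ, 0 < r → r < r₀ →
        ∃ N₀ : ℕ, ∀ N : ℕ, N₀ ≤ N → ∀ k l : Fin 3,
          localGibbsLaw σ (fun _ => (1 : ℝ)) (fun _ => (0 : V3)) (fun _ => (1 : ℝ)) N (Φ N)
            {z | η < |collisionSum σ N (Φ N) τ χ g (evenMark k l) r z -
                  σ ^ 3 * ∫ s in Set.Icc (0 : ℝ) τ, ∫ x : UnitAddTorus (Fin 3),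
                    χ (s, x) * g (σ ^ 3 * mollDensity r ((Φ N).flow s z) x) *
                      Yt (σ ^ 3 * mollDensity r ((Φ N).flow s z) x) *
                      pairFunctional r (evenMark k l) ((Φ N).flow s z) x|}
            ≤ ENNReal.ofReal δ) →
      (∃ σ₀ : ℝ, 0 < σ₀ ∧ ∀ σ : ℝ, 0 < σ → σ < σ₀ →
        ∀ Φ : (N : ℕ) → HardSphereFlow (Torus.geometry (Fin 3)) (hsDiameter σ N) (N + 1),
        ∀ τ : ℝ, 0 < τ → ∀ χ : ℝ × UnitAddTorus (Fin 3) → ℝ, Continuous χ → ∀ g : ℝ → ℝ, Continuous g →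
        (∀ a, ηR ≤ a → g a = 0) →
        ∀ η δ : ℝ, 0 < η → 0 < δ → ∃ r₀ : ℝ, 0 < r₀ ∧ ∀ r : ℝ, 0 < r → r < r₀ →
        ∃ N₀ : ℕ, ∀ N : ℕ, N₀ ≤ N → ∀ k l : Fin 3,
          localGibbsLaw σ (fun _ => (1 : ℝ)) (fun _ => (0 : V3)) (fun _ => (1 : ℝ)) N (Φ N)
            {z | η < |evenStat σ N (Φ N) τ χ g (evenMark k l) r z|} ≤ ENNReal.ofReal δ) →
      ∃ η₁ : ℝ, 0 < η₁ ∧ Set.EqOn Yt contactValue (Set.Ioo 0 η₁) :=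
  _root_.Summit.AtomisticToContinuum.HydrodynamicLimit.Theorems.EvenStressEnskog.stub_rungZeroPin

/-! ## The band rewriting (kernel-checked): agreement on `(0, η₁)` transfers (U) to the crux -/

/-- **Pointwise congruence of the prediction integrand** (the heart of the rewriting): for ONE configuration `w`, if
`Ỹ = Y` on `(0, η₁)` and the cutoff `g` vanishes on `[min η₀ η₁, ∞)`, then
`χ g(σ³ρ_r) Ỹ(σ³ρ_r) B_r = χ g(σ³ρ_r) Y(σ³ρ_r) B_r` at every `x`: where `ρ_r = 0` the pair functional vanishes (the
disprover's landed `pairFunctional_eq_zero_of_mollifiedDensity_eq_zero`, Disproof §4), where `0 < σ³ρ_r < min η₀ η₁`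
the two laws agree, and above the cutoff kills both sides. [folklore] -/
theorem predIntegrand_congr {Yt : ℝ → ℝ} {η₀ η₁ σ r : ℝ} (hσ : 0 < σ) (hr : 0 < r)
    (heq : Set.EqOn Yt contactValue (Set.Ioo 0 η₁)) {g : ℝ → ℝ} (hg0 : ∀ a, min η₀ η₁ ≤ a → g a = 0)
    {N : ℕ} (χ : ℝ × UnitAddTorus (Fin 3) → ℝ) (Ξ : V3 × V3 × V3 → ℝ) (w : Config (N + 1) (Fin 3) T3) (s : ℝ)
    (x : UnitAddTorus (Fin 3)) :
    χ (s, x) * g (σ ^ 3 * mollDensity r w x) * Yt (σ ^ 3 * mollDensity r w x) * pairFunctional r Ξ w x =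
      χ (s, x) * g (σ ^ 3 * mollDensity r w x) * contactValue (σ ^ 3 * mollDensity r w x) *
        pairFunctional r Ξ w x := by
  by_cases hρ : mollDensity r w x = 0
  · have hB : pairFunctional r Ξ w x = 0 := by
      have hρ' : ∫ q, 3 / (Real.pi * r ^ 3) * max (1 - Torus.euclidDist q.1 x / r) 0 ∂(empiricalMeasure w) = 0 := by
        simpa [mollDensity, coneKernel] using hρ
      have h0 := Summit.AtomisticToContinuum.HydrodynamicLimit.Theorems.EvenStressEnskog.pairFunctional_eq_zero_of_mollifiedDensity_eq_zero
        hr Ξ w x hρ'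
      simpa [pairFunctional, coneKernel, sphereMark] using h0
    rw [hB, mul_zero, mul_zero]
  · have h0 : 0 ≤ mollDensity r w x := by
      simp only [mollDensity, coneKernel]
      exact integral_nonneg fun q =>
        Summit.AtomisticToContinuum.HydrodynamicLimit.Theorems.EvenStressEnskog.coneMollifier_nonneg hr _ _
    have hpos : 0 < σ ^ 3 * mollDensity r w x := mul_pos (pow_pos hσ 3) (lt_of_le_of_ne h0 (Ne.symm hρ))
    by_cases hlt : σ ^ 3 * mollDensity r w x < min η₀ η₁
    · rw [heq ⟨hpos, hlt.trans_le (min_le_right _ _)⟩]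
    · rw [hg0 _ (not_lt.mp hlt)]
      ring

/-- **(U) with a law agreeing with `contactValue` on a band implies the crux** (card 1's `FirstLemmaA`, card 4's
`evenStressWith_congr_pos`; proved): shrink the threshold to `min η₀ η₁` (a cutoff vanishing on `[min η₀ η₁, ∞)`
vanishes on `[η₀, ∞)`), run (U), and rewrite the prediction integrand surely by `predIntegrand_congr`. [folklore] -/
theorem evenStressEnskog_of_eqOn_band {Yt : ℝ → ℝ} {η₀ η₁ : ℝ} (hη₀ : 0 < η₀) (hη₁ : 0 < η₁)
    (HU : ∀ (a₀ θ₀ : T3 → ℝ) (u₀ : T3 → V3), Continuous a₀ → Continuous θ₀ → Continuous u₀ →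
      (∀ x, 0 < a₀ x) → (∀ x, 0 < θ₀ x) → ∃ σ₀ : ℝ, 0 < σ₀ ∧ ∀ σ : ℝ, 0 < σ → σ < σ₀ →
      ∀ Φ : (N : ℕ) → HardSphereFlow (Torus.geometry (Fin 3)) (hsDiameter σ N) (N + 1),
      ∀ τ : ℝ, 0 < τ → ∀ χ : ℝ × UnitAddTorus (Fin 3) → ℝ, Continuous χ → ∀ g : ℝ → ℝ, Continuous g →
      (∀ a, η₀ ≤ a → g a = 0) →
      ∀ η δ : ℝ, 0 < η → 0 < δ → ∃ r₀ : ℝ, 0 < r₀ ∧ ∀ r : ℝ, 0 < r → r < r₀ →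
      ∃ N₀ : ℕ, ∀ N : ℕ, N₀ ≤ N → ∀ k l : Fin 3,
        localGibbsLaw σ a₀ u₀ θ₀ N (Φ N)
          {z | η < |collisionSum σ N (Φ N) τ χ g (evenMark k l) r z -
                σ ^ 3 * ∫ s in Set.Icc (0 : ℝ) τ, ∫ x : UnitAddTorus (Fin 3),
                  χ (s, x) * g (σ ^ 3 * mollDensity r ((Φ N).flow s z) x) *
                    Yt (σ ^ 3 * mollDensity r ((Φ N).flow s z) x) *
                    pairFunctional r (evenMark k l) ((Φ N).flow s z) x|}
          ≤ ENNReal.ofReal δ)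
    (heq : Set.EqOn Yt contactValue (Set.Ioo 0 η₁)) : EvenStressEnskog := by
  refine evenStressEnskog_iff.mpr ⟨min η₀ η₁, lt_min hη₀ hη₁, ?_⟩
  intro a₀ θ₀ u₀ ha hθ hu ha0 hθ0
  obtain ⟨σ₀, hσ₀, H1⟩ := HU a₀ θ₀ u₀ ha hθ hu ha0 hθ0
  refine ⟨σ₀, hσ₀, ?_⟩
  intro σ hσ hσlt Φ τ hτ χ hχ g hg hg0 η δ hη hδ
  have hg0' : ∀ a, η₀ ≤ a → g a = 0 := fun a h => hg0 a ((min_le_left η₀ η₁).trans h)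
  obtain ⟨r₀, hr₀, H2⟩ := H1 σ hσ hσlt Φ τ hτ χ hχ g hg hg0' η δ hη hδ
  refine ⟨r₀, hr₀, ?_⟩
  intro r hr hrlt
  obtain ⟨N₀, H3⟩ := H2 r hr hrlt
  refine ⟨N₀, ?_⟩
  intro N hN k l
  have key := H3 N hN k l
  have hint : ∀ (w : Config (N + 1) (Fin 3) T3) (s : ℝ) (x : UnitAddTorus (Fin 3)),
      χ (s, x) * g (σ ^ 3 * mollDensity r w x) * Yt (σ ^ 3 * mollDensity r w x) *
          pairFunctional r (evenMark k l) w x =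
        χ (s, x) * g (σ ^ 3 * mollDensity r w x) * contactValue (σ ^ 3 * mollDensity r w x) *
          pairFunctional r (evenMark k l) w x :=
    fun w s x => predIntegrand_congr hσ hr heq hg0 χ (evenMark k l) w s x
  simp_rw [hint] at key
  exact key

/-! ## The composition (kernel-checked, sorry-free) -/

/-- **`EvenStressEnskog` from (U), (R0), (Pin).**  Take the slaved law `Ỹ` and its threshold `η_U` from (U);
specialise (U) to the constant profile `(1, 0, 1)` and (R0) to `a = θ = 1` (threshold `η_R`); (Pin) returns a band
`(0, η₁)` on which `Ỹ = contactValue`; `evenStressEnskog_of_eqOn_band` rewrites (U) into the crux with threshold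
`min η_U η₁`. [folklore] -/
theorem EvenStressEnskog_of
    (hU : Stubs.stub_universalContactLaw) (hR : Stubs.stub_rungZeroEnskog) (hP : Stubs.stub_rungZeroPin) :
    EvenStressEnskog := by
  obtain ⟨Yt, ηU, hηU, hcont, HU⟩ := hU
  obtain ⟨ηR, hηR, HR⟩ := hR
  -- (U) at the constant profile (1, 0, 1)
  have HU0 := HU (fun _ => (1 : ℝ)) (fun _ => (1 : ℝ)) (fun _ => (0 : V3))
    continuous_const continuous_const continuous_const (fun _ => one_pos) (fun _ => one_pos)
  -- (R0) at a = θ = 1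
  have HR0 := HR 1 1 one_pos one_pos
  obtain ⟨η₁, hη₁, heq⟩ := hP Yt ηU ηR hηU hηR hcont HU0 HR0
  exact evenStressEnskog_of_eqOn_band hηU hη₁ HU heq

/-- **The converse: the crux implies (U)** (lead, 2026-08-16; makes the line's transfer an EQUIVALENCE, kernel-checked): take
`Ỹ := contactValue`, continuous on the analyticity band `(0, η_an)` of `HsEosLowDensity` (`continuousOn_contactValue_band`, landed with (Pin)), and
the threshold `min η₀ η_an`; a cutoff vanishing on `[min η₀ η_an, ∞)` vanishes on `[η₀, ∞)`, and the prediction with `contactValue` is the crux's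
own (the `Iff.rfl` bridge `evenStressEnskog_iff`).  Together with `EvenStressEnskog_of` and the landed (R0), (Pin): `EvenStressEnskog ↔ (U)`. [folklore] -/
theorem universalContactLaw_of_evenStressEnskog (h : EvenStressEnskog) : Stubs.stub_universalContactLaw := by
  obtain ⟨η₀, hη₀, H⟩ := evenStressEnskog_iff.mp h
  obtain ⟨ηa, hηa, hcont⟩ :=
    _root_.Summit.AtomisticToContinuum.HydrodynamicLimit.Theorems.EvenStressEnskog.continuousOn_contactValue_band
  refine ⟨contactValue, min η₀ ηa, lt_min hη₀ hηa, hcont.mono (Set.Ioo_subset_Ioo le_rfl (min_le_right _ _)), ?_⟩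
  intro a₀ θ₀ u₀ ha hθ hu ha0 hθ0
  obtain ⟨σ₀, hσ₀, H1⟩ := H a₀ θ₀ u₀ ha hθ hu ha0 hθ0
  refine ⟨σ₀, hσ₀, fun σ hσ hσlt Φ τ hτ χ hχ g hg hg0 η δ hη hδ => ?_⟩
  exact H1 σ hσ hσlt Φ τ hτ χ hχ g hg (fun a ha' => hg0 a ((min_le_left η₀ ηa).trans ha')) η δ hη hδ

/-- **The crux is EXACTLY its value-free form** (given the landed statics (R0) and identification (Pin)): `EvenStressEnskog ↔ (U)`. [folklore] -/
theorem evenStressEnskog_iff_universalContactLaw : EvenStressEnskog ↔ Stubs.stub_universalContactLaw :=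
  ⟨universalContactLaw_of_evenStressEnskog, fun hU => EvenStressEnskog_of hU stub_rungZeroEnskog stub_rungZeroPin⟩

/-- **The skeleton IS the crux proof modulo the registered stubs** (D-0027 §3.3 shape): sorry-free itself; its only
gaps are the three `stub_*` theorems above (matched against the statement `Prop`s `Stubs.stub_*` by `rfl`-unfolding).
[folklore] -/
theorem EvenStressEnskog_proof : EvenStressEnskog :=
  EvenStressEnskog_of stub_universalContactLaw stub_rungZeroEnskog stub_rungZeroPin

/-! ## Support signatures (NOT stubs, not registered; no `sorry`): the card's lever and what it proves -/

/-- **THE CARD'S LEVER, typed — ISOTHERMAL ENTROPY BUDGET** (exact, every `N`, every `σ`; provable now, M): for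
isothermal zero-drift local Gibbs data (`θ₀ ≡ θ`, `u₀ ≡ 0`, activity `a₀` with `L`-Lipschitz logarithm) Liouville
invariance (`HardSphereFlow.lawAt_withDensity_holds`) and energy conservation (`configEnergy_eq_holds`) give the
IDENTITY `H(P_t | LG₀) = E_{LG₀} Σ_i [log a₀(x_i(0)) − log a₀(x_i(t))]` (the Maxwellian factor of `log LG₀` is a
function of the conserved kinetic energy, the partition function cancels pathwise), hence, by the path-length bound
`dist(x_i(t), x_i(0)) ≤ ∫₀ᵗ |v_i|` and Cauchy–Schwarz against the conserved energy, `H(P_t | LG₀) ≤ (N+1)·L·√(3θ)·t`: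
the evolved law drifts from the INITIAL local Gibbs law by `O(t)` nats per particle — no cubic velocity moment, no
collision count (re-derived by triage r1-1 §A, r1-2 §A, r1-3 Check.lean `isothermal_logRatio`/`abs_sum_logRatio_le`).
Not load-bearing for THIS skeleton (the pin is at rung 0, where `L = 0` and the budget degenerates into the proved
invariance `map_flow_localGibbsLaw_const`); kept as the typed `t = 0⁺` tool for attacking (U) itself and for
`ShortTimeEnskogStress` below; file it `--supports stmt-AtomisticToContinuum-13079` when wanted.
[cite: OllaVaradhanYau1993, §3] -/
def IsothermalEntropyBudget : Prop :=
  ∀ (σ θ L : ℝ) (a₀ : T3 → ℝ), 0 < θ → 0 ≤ L → Continuous a₀ → (∀ x, 0 < a₀ x) →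
    (∀ x y, |Real.log (a₀ x) - Real.log (a₀ y)| ≤ L * Torus.euclidDist x y) →
    ∀ (N : ℕ) (Φ : HardSphereFlow (Torus.geometry (Fin 3)) (hsDiameter σ N) (N + 1)) (t : ℝ), 0 ≤ t →
      InformationTheory.klDiv
          (Φ.lawAt (localGibbsLaw σ a₀ (fun _ => 0) (fun _ => θ) N Φ) t)
          (localGibbsLaw σ a₀ (fun _ => 0) (fun _ => θ) N Φ) ≤
        ENNReal.ofReal (((N : ℝ) + 1) * L * Real.sqrt (3 * θ) * t)

/-- **What the lever proves — SHORT-TIME ENSKOG STRESS at relative precision** (the first inhomogeneous, genuinely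
time-evolved regime beyond rung 0; NOT a stub, not needed by `EvenStressEnskog_of`): for isothermal zero-drift local
Gibbs data the crux's statistic is small RELATIVE TO THE WINDOW, `|evenStat| ≤ η·τ` with probability `≥ 1 − δ`, for all
horizons `τ ≤ t₀(profile, g, η, δ)` (then `χ`, then `r`, then `N`, in the crux's order).  Route to it: the windowed
collision sum over `[0, τ]` is, up to a short-flight remainder of relative size `O(τ/t_mfp)`, the pre-collision-tube
U-statistic read at the times `s ≤ τ`, whose law under `LG₀` obeys a static LDP at speed `N` around the Enskog
prediction with the CANONICAL contact value `Y_N → contactValue`; the entropy inequality for events with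
`IsothermalEntropyBudget` (`H ≤ (N+1)L√(3θ)s`) transports the LDP bound to the evolved law at the price `L√(3θ)t₀/I(η)`,
which is `≤ δ` for `t₀` small.  (For `τ → 0` at FIXED precision the statement would be trivial — both terms are `O(τ)` —
hence the relative form `η * τ`.) [cite: OllaVaradhanYau1993, §3] -/
def ShortTimeEnskogStress : Prop :=
  ∃ η₀ : ℝ, 0 < η₀ ∧ ∀ (a₀ : T3 → ℝ) (θ : ℝ), Continuous a₀ → (∀ x, 0 < a₀ x) → 0 < θ →
    (∃ L : ℝ, ∀ x y, |Real.log (a₀ x) - Real.log (a₀ y)| ≤ L * Torus.euclidDist x y) →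
    ∃ σ₀ : ℝ, 0 < σ₀ ∧ ∀ σ : ℝ, 0 < σ → σ < σ₀ →
    ∀ Φ : (N : ℕ) → HardSphereFlow (Torus.geometry (Fin 3)) (hsDiameter σ N) (N + 1),
    ∀ g : ℝ → ℝ, Continuous g → (∀ a, η₀ ≤ a → g a = 0) →
    ∀ η δ : ℝ, 0 < η → 0 < δ → ∃ t₀ : ℝ, 0 < t₀ ∧ ∀ τ : ℝ, 0 < τ → τ ≤ t₀ →
    ∀ χ : ℝ × UnitAddTorus (Fin 3) → ℝ, Continuous χ → (∀ p, |χ p| ≤ 1) →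
    ∃ r₀ : ℝ, 0 < r₀ ∧ ∀ r : ℝ, 0 < r → r < r₀ → ∃ N₀ : ℕ, ∀ N : ℕ, N₀ ≤ N → ∀ k l : Fin 3,
      localGibbsLaw σ a₀ (fun _ => (0 : V3)) (fun _ => θ) N (Φ N)
        {z | η * τ < |evenStat σ N (Φ N) τ χ g (evenMark k l) r z|} ≤ ENNReal.ofReal δ

end

end Summit.AtomisticToContinuum.HydrodynamicLimit.Cruxes.EvenStressEnskog.LiouvilleContinuityPinsUniversalContactValue
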